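import Summits.QuantumFields.YangMills.Theses.FradkinShenkerFlow

/-!
# Cylinder geometry, heat-bath weights and explicit scales (helper for stub `stub_bisection`, C4)

Route `FradkinShenkerFlow` of `YangMills`, crux item `stmt-QuantumFields-9441`
(`Summit.QuantumFields.YangMills.Theses.FradkinShenkerFlow.SusceptibilityToPoincare`, FS ⇒ UP),
line `maxcorr-halving`, stub `stub_bisection` (Martinelli's bisection in maximal-correlation
currency).  This file collects the purely combinatorial and numerical bookkeeping of that stub.

A *cylinder* of the torus `(ℤ/L)^d` with base point `a` and sides `n` is the site set
`{x | ∀ ν, (x ν - a ν).val < n ν}`; the *heat-bath weight* of a site set `Q` for a nonnegative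
weight `e` on edges is `Σ_ℓ 1[ℓ.1 ∈ Q] e ℓ`.

* `Bisect.val_sub_natCast_cases`: the value of `y - c` in `ZMod L` (`c < L`) is `y.val - c` or
  `y.val - c + L`.
* `Bisect.cyl_inter_lt`, `Bisect.cyl_inter_le`, `Bisect.cyl_rebase`, `Bisect.cyl_eq_univ`,
  `Bisect.inter_lt_union_inter_le`: cutting a cylinder at an offset in one direction gives
  cylinders again (explicit base points and sides), and the two children of a corridor cut cover
  it; a full-ring side can be re-based; the cylinder with all sides `L` is the whole torus.
* `Bisect.card_filter_update_lt`: replacing one side by a "short" one lowers the number of "long"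
  sides.
* `Bisect.hb_nonneg`, `Bisect.hb_mono`, `Bisect.hb_union_add_inter`, `Bisect.hb_univ`,
  `Bisect.sum_hb_corridor_le`: the heat-bath weight is nonnegative, monotone, a valuation, and
  disjoint corridors of a site set carry at most its total weight.
* `Bisect.scales_fit`, `Bisect.scales_fit'`, `Bisect.le_scales`: the explicit scales
  `l k = R (2k³ + 12k² + 36k + 52)` with `(k+1)²` corridor positions of `2(k+1)` slabs of width
  `R` satisfy `l (k+1) + (k+1)² · 2(k+1) R ≤ 2 l k`, `(k+1)² · 2(k+1) R + R ≤ l k`, `k ≤ l k`.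
* `Bisect.prod_stepFactor_le`: the step factors of the scale recursion have a bounded product,
  `Π_{j<k} (1 - ρ^{j+1})⁻² (1 + 1/(j+1)²) ≤ exp (2ρ/(1-ρ)² + 2)`, from `1/(1-x) ≤ exp (x/(1-ρ))`
  (`0 ≤ x ≤ ρ < 1`), `1 + y ≤ exp y`, the geometric series and `Σ_{j<k} 1/(j+1)² ≤ 2 - 2/(k+1)`;
  restated in closed form as the registered sub-goal `stub_bisection_stepFactors`.
-/

open Literature.MathematicalPhysics.QuantumFieldTheory

namespace Summit.QuantumFields.YangMills.Theorems.SusceptibilityToPoincare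

namespace Bisect

/-! ### Arithmetic in `ZMod L` -/

section ZModFacts

variable {L : ℕ} [NeZero L]

/-- For `y : ZMod L` and `c < L`: either `c ≤ y.val` and `(y - c).val = y.val - c`, or
`y.val < c` and `(y - c).val = y.val + L - c`. [folklore] -/
theorem val_sub_natCast_cases (y : ZMod L) {c : ℕ} (hc : c < L) :
    ((y - (c : ZMod L)).val + c = y.val ∧ c ≤ y.val) ∨
      ((y - (c : ZMod L)).val + c = y.val + L ∧ y.val < c) := by
  have h := ZMod.val_add (y - (c : ZMod L)) (c : ZMod L)
  rw [sub_add_cancel, ZMod.val_cast_of_lt hc] at h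
  have hu := ZMod.val_lt (y - (c : ZMod L))
  have ht := ZMod.val_lt y
  by_cases hlt : (y - (c : ZMod L)).val + c < L
  · rw [Nat.mod_eq_of_lt hlt] at h
    left
    omega
  · rw [Nat.mod_eq_sub_mod (not_lt.1 hlt), Nat.mod_eq_of_lt (by omega)] at h
    right
    omega

/-- Removing the first `c` layers of an interval side: for `c ≤ n ≤ L`, `c < L`,
`y.val < n ∧ c ≤ y.val ↔ (y - c).val < n - c`. [folklore] -/
theorem val_lt_and_le_val_iff (y : ZMod L) {c n : ℕ} (hcn : c ≤ n) (hn : n ≤ L) (hc : c < L) :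
    (y.val < n ∧ c ≤ y.val) ↔ (y - (c : ZMod L)).val < n - c := by
  rcases val_sub_natCast_cases y hc with ⟨h1, h2⟩ | ⟨h1, h2⟩ <;> omega

end ZModFacts

/-! ### Cylinders -/

section Cylinders

variable {d L : ℕ}

/-- Cutting a cylinder below an offset in direction `i` gives the cylinder with the same base
point and the `i`-th side replaced by `min (n i) c'`. [folklore] -/
theorem cyl_inter_lt (a : Fin d → ZMod L) (n : Fin d → ℕ) (i : Fin d) (c' : ℕ) :
    {x | x ∈ {x : Site d L | ∀ ν, (x ν - a ν).val < n ν} ∧ (x i - a i).val < c'} =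
      {x : Site d L | ∀ ν, (x ν - a ν).val < Function.update n i (min (n i) c') ν} := by
  ext x
  simp only [Set.mem_setOf_eq]
  rw [Function.forall_update_iff n (p := fun ν t => (x ν - a ν).val < t), lt_min_iff]
  constructor
  · rintro ⟨h, hi⟩
    exact ⟨⟨h i, hi⟩, fun ν _ => h ν⟩
  · rintro ⟨⟨hi, hc⟩, h⟩
    refine ⟨fun ν => ?_, hc⟩
    by_cases hν : ν = i
    · subst hν; exact hi
    · exact h ν hν

/-- Cutting a cylinder above the offset `c` in direction `i` (`c ≤ n i ≤ L`, `c < L`) gives the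
cylinder with base point moved by `c` in direction `i` and `i`-th side `n i - c`. [folklore] -/
theorem cyl_inter_le [NeZero L] (a : Fin d → ZMod L) (n : Fin d → ℕ) (i : Fin d) {c : ℕ}
    (hcn : c ≤ n i) (hn : n i ≤ L) (hc : c < L) :
    {x | x ∈ {x : Site d L | ∀ ν, (x ν - a ν).val < n ν} ∧ c ≤ (x i - a i).val} =
      {x : Site d L | ∀ ν, (x ν - Function.update a i (a i + (c : ZMod L)) ν).val <
        Function.update n i (n i - c) ν} := by
  ext x
  simp only [Set.mem_setOf_eq]
  constructor
  · rintro ⟨h, hi⟩ ν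
    by_cases hν : ν = i
    · subst hν
      rw [Function.update_self, Function.update_self, ← sub_sub]
      exact (val_lt_and_le_val_iff _ hcn hn hc).1 ⟨h ν, hi⟩
    · rw [Function.update_of_ne hν, Function.update_of_ne hν]
      exact h ν
  · intro h
    have hi := h i
    rw [Function.update_self, Function.update_self, ← sub_sub,
      ← val_lt_and_le_val_iff _ hcn hn hc] at hi
    refine ⟨fun ν => ?_, hi.2⟩
    by_cases hν : ν = i
    · subst hν; exact hi.1
    · have := h ν
      rwa [Function.update_of_ne hν, Function.update_of_ne hν] at this

/-- A full-ring side (`n i = L`) can be re-based at any point. [folklore] -/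
theorem cyl_rebase [NeZero L] (a : Fin d → ZMod L) (n : Fin d → ℕ) (i : Fin d) (hn : n i = L)
    (t : ZMod L) :
    {x : Site d L | ∀ ν, (x ν - a ν).val < n ν} =
      {x : Site d L | ∀ ν, (x ν - Function.update a i t ν).val < n ν} := by
  ext x
  simp only [Set.mem_setOf_eq]
  refine forall_congr' fun ν => ?_
  by_cases hν : ν = i
  · subst hν
    rw [Function.update_self, hn]
    exact iff_of_true (ZMod.val_lt _) (ZMod.val_lt _)
  · rw [Function.update_of_ne hν]

/-- The cylinder all of whose sides are the full ring is the whole torus. [folklore] -/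
theorem cyl_eq_univ [NeZero L] (a : Fin d → ZMod L) (n : Fin d → ℕ) (hn : ∀ ν, n ν = L) :
    {x : Site d L | ∀ ν, (x ν - a ν).val < n ν} = Set.univ :=
  Set.eq_univ_of_forall fun _ ν => (hn ν).symm ▸ ZMod.val_lt _

/-- The two children of a corridor cut cover the cylinder. [folklore] -/
theorem inter_lt_union_inter_le (Q : Set (Site d L)) (off : Site d L → ℕ) (c c' : ℕ)
    (h : c ≤ c') : {x | x ∈ Q ∧ off x < c'} ∪ {x | x ∈ Q ∧ c ≤ off x} = Q := by
  ext y
  simp only [Set.mem_union, Set.mem_setOf_eq]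
  constructor
  · rintro (⟨hx, _⟩ | ⟨hx, _⟩) <;> exact hx
  · intro hx
    rcases le_or_gt c (off y) with hc | hc
    · exact Or.inr ⟨hx, hc⟩
    · exact Or.inl ⟨hx, by omega⟩

/-- Replacing the `i`-th side by one failing `P` lowers the number of sides satisfying `P`,
when the old `i`-th side satisfied `P`. [folklore] -/
theorem card_filter_update_lt (n : Fin d → ℕ) (i : Fin d) (t : ℕ) (P : ℕ → Prop)
    [DecidablePred P] (ht : ¬ P t) (hi : P (n i)) :
    (Finset.univ.filter fun ν => P (Function.update n i t ν)).card + 1 =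
      (Finset.univ.filter fun ν => P (n ν)).card := by
  have hmem : i ∈ Finset.univ.filter fun ν => P (n ν) := by simp [hi]
  have heq : (Finset.univ.filter fun ν => P (Function.update n i t ν)) =
      (Finset.univ.filter fun ν => P (n ν)).erase i := by
    ext ν
    by_cases hν : ν = i
    · subst hν; simp [ht]
    · simp [hν]
  rw [heq, Finset.card_erase_of_mem hmem]
  have := Finset.card_pos.2 ⟨i, hmem⟩
  omega

end Cylinders

/-! ### Heat-bath weights of site sets -/

section Weights

variable {d L : ℕ} [NeZero L] (e : Edge d L → ℝ)

/-- The heat-bath weight of a site set is nonnegative. [folklore] -/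
theorem hb_nonneg (he : ∀ ℓ, 0 ≤ e ℓ) (Q : Set (Site d L)) :
    0 ≤ ∑ ℓ, {ℓ : Edge d L | ℓ.1 ∈ Q}.indicator e ℓ :=
  Finset.sum_nonneg fun _ _ => Set.indicator_nonneg (fun _ _ => he _) _

/-- The heat-bath weight is monotone in the site set. [folklore] -/
theorem hb_mono (he : ∀ ℓ, 0 ≤ e ℓ) {Q Q' : Set (Site d L)} (h : Q ⊆ Q') :
    ∑ ℓ, {ℓ : Edge d L | ℓ.1 ∈ Q}.indicator e ℓ ≤ ∑ ℓ, {ℓ : Edge d L | ℓ.1 ∈ Q'}.indicator e ℓ :=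
  Finset.sum_le_sum fun ℓ _ =>
    Set.indicator_le_indicator_of_subset
      (show {ℓ : Edge d L | ℓ.1 ∈ Q} ⊆ {ℓ : Edge d L | ℓ.1 ∈ Q'} from fun _ hℓ => h hℓ)
      (fun _ => he _) ℓ

/-- The heat-bath weight is a valuation: `hb Q₁ + hb Q₂ = hb (Q₁ ∪ Q₂) + hb (Q₁ ∩ Q₂)`. [folklore] -/
theorem hb_union_add_inter (Q₁ Q₂ : Set (Site d L)) :
    ∑ ℓ, {ℓ : Edge d L | ℓ.1 ∈ Q₁}.indicator e ℓ + ∑ ℓ, {ℓ : Edge d L | ℓ.1 ∈ Q₂}.indicator e ℓ =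
      ∑ ℓ, {ℓ : Edge d L | ℓ.1 ∈ Q₁ ∪ Q₂}.indicator e ℓ +
        ∑ ℓ, {ℓ : Edge d L | ℓ.1 ∈ Q₁ ∩ Q₂}.indicator e ℓ := by
  rw [← Finset.sum_add_distrib, ← Finset.sum_add_distrib]
  refine Finset.sum_congr rfl fun ℓ _ => ?_
  by_cases h1 : ℓ.1 ∈ Q₁ <;> by_cases h2 : ℓ.1 ∈ Q₂ <;> simp [h1, h2]

/-- The heat-bath weight of the whole torus is the full heat-bath form. [folklore] -/
theorem hb_univ : ∑ ℓ, {ℓ : Edge d L | ℓ.1 ∈ (Set.univ : Set (Site d L))}.indicator e ℓ = ∑ ℓ, e ℓ :=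
  Finset.sum_congr rfl fun _ _ => Set.indicator_of_mem (Set.mem_univ _) _

/-- Disjoint corridors `{c₀ + p w ≤ off < c₀ + p w + w}` (`p < s`) of a site set carry at most its
total heat-bath weight. [folklore] -/
theorem sum_hb_corridor_le (he : ∀ ℓ, 0 ≤ e ℓ) (Q : Set (Site d L)) (off : Site d L → ℕ)
    (c₀ w s : ℕ) :
    ∑ p ∈ Finset.range s, ∑ ℓ, {ℓ : Edge d L | ℓ.1 ∈
        {x | x ∈ Q ∧ off x < c₀ + p * w + w} ∩ {x | x ∈ Q ∧ c₀ + p * w ≤ off x}}.indicator e ℓ ≤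
      ∑ ℓ, {ℓ : Edge d L | ℓ.1 ∈ Q}.indicator e ℓ := by
  classical
  rw [Finset.sum_comm]
  refine Finset.sum_le_sum fun ℓ _ => ?_
  by_cases hQ : ℓ.1 ∈ Q
  · rw [Set.indicator_of_mem (show ℓ ∈ {ℓ : Edge d L | ℓ.1 ∈ Q} from hQ)]
    simp only [Set.indicator_apply, Set.mem_setOf_eq, Set.mem_inter_iff, hQ, true_and]
    rw [Finset.sum_ite, Finset.sum_const_zero, add_zero, Finset.sum_const, nsmul_eq_mul]
    refine mul_le_of_le_one_left (he ℓ) ?_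
    have hcard : ((Finset.range s).filter fun p =>
        off ℓ.1 < c₀ + p * w + w ∧ c₀ + p * w ≤ off ℓ.1).card ≤ 1 := by
      refine Finset.card_le_one.2 fun p hp q hq => ?_
      simp only [Finset.mem_filter] at hp hq
      have h1 : p * w < (q + 1) * w := by rw [add_one_mul]; omega
      have h2 : q * w < (p + 1) * w := by rw [add_one_mul]; omega
      have := Nat.lt_of_mul_lt_mul_right h1
      have := Nat.lt_of_mul_lt_mul_right h2
      omega
    exact_mod_cast hcard
  · have h0 : {ℓ : Edge d L | ℓ.1 ∈ Q}.indicator e ℓ = 0 :=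
      Set.indicator_of_notMem (s := {ℓ : Edge d L | ℓ.1 ∈ Q}) hQ e
    rw [h0]
    refine (Finset.sum_eq_zero fun p _ => Set.indicator_of_notMem ?_ _).le
    simp only [Set.mem_setOf_eq, Set.mem_inter_iff, not_and]
    exact fun h => absurd h.1 hQ

end Weights


/-! ### The scales -/

/-- `l (k+1) + s k · (m k · R) ≤ 2 l k` for the explicit scales (an identity). [folklore] -/
theorem scales_fit (R k : ℕ) :
    R * (2 * (k + 1) ^ 3 + 12 * (k + 1) ^ 2 + 36 * (k + 1) + 52) +
        (k + 1) ^ 2 * (2 * (k + 1) * R) ≤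
      2 * (R * (2 * k ^ 3 + 12 * k ^ 2 + 36 * k + 52)) :=
  le_of_eq (by ring)

/-- `s k · (m k · R) + R ≤ l k` for the explicit scales. [folklore] -/
theorem scales_fit' (R k : ℕ) :
    (k + 1) ^ 2 * (2 * (k + 1) * R) + R ≤ R * (2 * k ^ 3 + 12 * k ^ 2 + 36 * k + 52) := by
  have h : (k + 1) ^ 2 * (2 * (k + 1) * R) + R = R * (2 * k ^ 3 + 6 * k ^ 2 + 6 * k + 3) := by
    ring
  rw [h]
  exact Nat.mul_le_mul_left R (by nlinarith [Nat.zero_le k])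

/-- `k ≤ l k` for the explicit scales (`R ≥ 1`). [folklore] -/
theorem le_scales {R : ℕ} (hR : 1 ≤ R) (k : ℕ) :
    k ≤ R * (2 * k ^ 3 + 12 * k ^ 2 + 36 * k + 52) :=
  calc k ≤ 2 * k ^ 3 + 12 * k ^ 2 + 36 * k + 52 := by nlinarith [Nat.zero_le k]
    _ ≤ R * (2 * k ^ 3 + 12 * k ^ 2 + 36 * k + 52) := Nat.le_mul_of_pos_left _ hR

/-! ### The product of the step factors -/

/-- `Σ_{j<k} 1/(j+1)² ≤ 2 - 2/(k+1)`. [folklore] -/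
theorem sum_one_div_sq_le (k : ℕ) :
    ∑ j ∈ Finset.range k, 1 / ((j : ℝ) + 1) ^ 2 ≤ 2 - 2 / ((k : ℝ) + 1) := by
  induction k with
  | zero => simp
  | succ k ih =>
    rw [Finset.sum_range_succ]
    have hk : (0 : ℝ) < (k : ℝ) + 1 := by positivity
    have key : 1 / ((k : ℝ) + 1) ^ 2 ≤ 2 / ((k : ℝ) + 1) - 2 / ((k : ℝ) + 1 + 1) := by
      rw [div_sub_div _ _ hk.ne' (by positivity), div_le_div_iff₀ (by positivity) (by positivity)]
      nlinarith
    push_cast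
    linarith

/-- `Σ_{j<k} ρ^{j+1} ≤ ρ/(1-ρ)` for `0 ≤ ρ < 1`. [folklore] -/
theorem sum_pow_succ_le {ρ : ℝ} (hρ : 0 ≤ ρ) (hρ1 : ρ < 1) (k : ℕ) :
    ∑ j ∈ Finset.range k, ρ ^ (j + 1) ≤ ρ / (1 - ρ) := by
  have h1 : 0 < 1 - ρ := by linarith
  have hgeom : (∑ j ∈ Finset.range k, ρ ^ j) * (1 - ρ) = 1 - ρ ^ k := geom_sum_mul_neg ρ k
  have hsum : ∑ j ∈ Finset.range k, ρ ^ (j + 1) = ρ * ∑ j ∈ Finset.range k, ρ ^ j := by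
    rw [Finset.mul_sum]
    exact Finset.sum_congr rfl fun j _ => by ring
  rw [hsum, le_div_iff₀ h1, mul_assoc, hgeom]
  nlinarith [pow_nonneg hρ k]

/-- `1/(1-x)² ≤ exp (2x/(1-ρ))` for `0 ≤ x ≤ ρ < 1`. [folklore] -/
theorem one_div_sq_le_exp {ρ x : ℝ} (hρ1 : ρ < 1) (hx : 0 ≤ x) (hxρ : x ≤ ρ) :
    1 / (1 - x) ^ 2 ≤ Real.exp (2 * x / (1 - ρ)) := by
  have h1 : 0 < 1 - x := by linarith
  have hle : 1 / (1 - x) ≤ Real.exp (x / (1 - ρ)) := by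
    have hfrac : x / (1 - x) ≤ x / (1 - ρ) :=
      div_le_div_of_nonneg_left hx (by linarith) (by linarith)
    calc 1 / (1 - x) = x / (1 - x) + 1 := by field_simp; ring
      _ ≤ x / (1 - ρ) + 1 := by linarith
      _ ≤ Real.exp (x / (1 - ρ)) := Real.add_one_le_exp _
  calc 1 / (1 - x) ^ 2 = (1 / (1 - x)) ^ 2 := by rw [one_div_pow]
    _ ≤ Real.exp (x / (1 - ρ)) ^ 2 := pow_le_pow_left₀ (by positivity) hle 2
    _ = Real.exp (2 * x / (1 - ρ)) := by rw [sq, ← Real.exp_add]; ring_nf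

/-- **The step factors have a bounded product**:
`Π_{j<k} (1 - ρ^{(2(j+1))/2})⁻² (1 + 1/(j+1)²) ≤ exp (2ρ/(1-ρ)² + 2)`. [folklore] -/
theorem prod_stepFactor_le {ρ : ℝ} (hρ : 0 ≤ ρ) (hρ1 : ρ < 1) (k : ℕ) :
    ∏ j ∈ Finset.range k, (1 / (1 - ρ ^ (2 * (j + 1) / 2)) ^ 2 *
        (1 + 1 / (((j + 1) ^ 2 : ℕ) : ℝ))) ≤ Real.exp (2 * ρ / (1 - ρ) ^ 2 + 2) := by
  have h1 : 0 < 1 - ρ := by linarith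
  have hfac : ∀ j ∈ Finset.range k, (1 / (1 - ρ ^ (2 * (j + 1) / 2)) ^ 2 *
      (1 + 1 / (((j + 1) ^ 2 : ℕ) : ℝ))) ≤
        Real.exp (2 * ρ ^ (j + 1) / (1 - ρ) + 1 / ((j : ℝ) + 1) ^ 2) := fun j _ => by
    have hj : 2 * (j + 1) / 2 = j + 1 := by omega
    rw [hj, Real.exp_add]
    push_cast
    refine mul_le_mul (one_div_sq_le_exp hρ1 (pow_nonneg hρ _)
      (by simpa using pow_le_pow_of_le_one hρ hρ1.le (Nat.succ_pos j))) ?_ (by positivity)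
      (Real.exp_pos _).le
    have := Real.add_one_le_exp (1 / ((j : ℝ) + 1) ^ 2)
    linarith
  have hnonneg : ∀ j ∈ Finset.range k, (0 : ℝ) ≤ (1 / (1 - ρ ^ (2 * (j + 1) / 2)) ^ 2 *
      (1 + 1 / (((j + 1) ^ 2 : ℕ) : ℝ))) := fun j _ => by positivity
  calc ∏ j ∈ Finset.range k, (1 / (1 - ρ ^ (2 * (j + 1) / 2)) ^ 2 *
          (1 + 1 / (((j + 1) ^ 2 : ℕ) : ℝ)))
      ≤ ∏ j ∈ Finset.range k, Real.exp (2 * ρ ^ (j + 1) / (1 - ρ) + 1 / ((j : ℝ) + 1) ^ 2) :=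
        Finset.prod_le_prod hnonneg hfac
    _ = Real.exp (∑ j ∈ Finset.range k, (2 * ρ ^ (j + 1) / (1 - ρ) + 1 / ((j : ℝ) + 1) ^ 2)) :=
        (Real.exp_sum _ _).symm
    _ ≤ Real.exp (2 * ρ / (1 - ρ) ^ 2 + 2) := by
        refine Real.exp_le_exp.2 ?_
        rw [Finset.sum_add_distrib]
        have hA : ∑ j ∈ Finset.range k, 2 * ρ ^ (j + 1) / (1 - ρ) ≤ 2 * ρ / (1 - ρ) ^ 2 := by
          rw [← Finset.sum_div, ← Finset.mul_sum, div_le_div_iff₀ h1 (by positivity)]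
          have := sum_pow_succ_le hρ hρ1 k
          rw [le_div_iff₀ h1] at this
          nlinarith
        have hB := sum_one_div_sq_le k
        have hC : (0 : ℝ) ≤ 2 / ((k : ℝ) + 1) := by positivity
        linarith

end Bisect

/-- **Registered sub-goal `stub_bisection_stepFactors` of stub `stub_bisection` (C4)**: the step
factors of Martinelli's scale recursion with `2(j+1)` slabs per corridor and `(j+1)²` corridor
positions have a product bounded uniformly in the number of scales,
`Π_{j<k} (1 - ρ^{(2(j+1))/2})⁻² (1 + 1/(j+1)²) ≤ exp (2ρ/(1-ρ)² + 2)` for `0 ≤ ρ < 1`. [folklore] -/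
theorem stub_bisection_stepFactors :
    ∀ (ρ : ℝ), 0 ≤ ρ → ρ < 1 → ∀ k : ℕ,
      ∏ j ∈ Finset.range k, (1 / (1 - ρ ^ (2 * (j + 1) / 2)) ^ 2 *
        (1 + 1 / (((j + 1) ^ 2 : ℕ) : ℝ))) ≤ Real.exp (2 * ρ / (1 - ρ) ^ 2 + 2) :=
  fun _ hρ hρ1 k => Bisect.prod_stepFactor_le hρ hρ1 k

end Summit.QuantumFields.YangMills.Theorems.SusceptibilityToPoincare
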